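import Summits.BirchSwinnertonDyer.BirchSwinnertonDyer.Theorems.PrintCf2RubinValueTwoUnrSelmerInvariantsGeneric
import Summits.BirchSwinnertonDyer.BirchSwinnertonDyer.Theorems.PrintCf2SplitBadTwoLineLocallyTrivialAwayP
import Summits.BirchSwinnertonDyer.BirchSwinnertonDyer.Theorems.PrintCf2SplitBadTwoRestrictedSelmerCokernelFinite
import Summits.BirchSwinnertonDyer.BirchSwinnertonDyer.Theorems.PrintCf2SplitBadTwoCMPrimaryPinningSwap
import Summits.BirchSwinnertonDyer.BirchSwinnertonDyer.Theorems.PrintCf2SplitBadTwoLocalControlKernelDyadicCM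
import Summits.BirchSwinnertonDyer.BirchSwinnertonDyer.Theorems.PrintCf2SplitBadTwoRestrictedSelmerBaseFiniteOfFrame
import Summits.BirchSwinnertonDyer.BirchSwinnertonDyer.Theorems.PrintCf2RubinValueTwoLinePushSpecialisation
import HarnessLib

/-!
# Route C `PrintCf2RubinValueTwo` / road α skeleton v12, crux `RestrictedMainConjWithValueAtTwo` (stmt-BirchSwinnertonDyer-23722), (unr-INV) file 2 —
# ON THE FRAMES: `H¹_{𝓕_nr}(K*_∞, W*)^Γ` IS FINITE, hypothesis-free — the input `hΓ` of cf2c-w8 g2's `LinePush.exists_charGenerator_unr_of_frame`;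
# hence EVERY Greenberg–Vatsal dual datum of the unramified line group is finitely generated, torsion, with `H(0) ≠ 0`

Cell `bsd-print-cf2`, width seat `bsd-line-cf2c-w2` g2 (prover-bsd-line-cf2c-w2-g2-0); `--supports stmt-BirchSwinnertonDyer-23722` (helper). Sequel of
file 1 `…UnrSelmerInvariantsGeneric` (generic local + global lemmas). HONEST FRAMING: nothing here closes the crux or a registered stub; BSD is not
proved by any of this; no summit statement is proved by this seat. No definition, no named fact, no `sorry`.

* §3 ROAD α: **`finite_fixedPoints_inertia_vbar_of_frame`** — `W*^{I_v̄}` is FINITE on every frame pinned at `v` (pinning swap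
  `CMPrimes.endEigenPrimaryTorsion_two_pinningClause_swap` + cocyclicity `CMPrimes.eq_of_le_of_infinite`);
  **`finite_endInvariants_conjUnr_of_frame_of_finite_restrictedSelmerBase`** — (unr-INV) from `Finite 𝔖_{v̄}(K, W*)` (file 1 + -w5
  `finite_endInvariants_of_frame_of_finite_restrictedSelmerBase` + -w6 g4 `LineLocallyTrivial.awayKer_eq_unramifiedKer_of_frame`);
  **`finite_endInvariants_conjUnr_of_frame`** — (unr-INV) on the v12 frame with NO displayed hypothesis ((FIN) = p688193
  `RelaxationLift.finite_restrictedSelmerBase_of_frame`); **`datumDualData_unr_of_frame`** — for EVERY `D : DatumDualData κ' γ' W* (bdpData W* 2 v̄) ∅` on the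
  v12 frame: `Module.Finite Λ D.X ∧ IsTorsion Λ D.X ∧ ∃ H, ch_Λ(D.X) = (H) ∧ H(0) ≠ 0` (read-out through cf2c-w8 g2's
  `LinePush.finite_isTorsion_exists_charIdeal_of_finite_endInvariants_unr`, Greenberg Lemma 4.2 and Remark).
presearch: Greenberg LNM 1716 §3–§4; Greenberg–Vatsal 2000 §2; Agboola 2007 §3–§6; Rubin LNM 1716 §3 Cor. 3.17 — held; assembly of tree theorems,
no new fact. beyond-print theorem: no.

References: [GreenbergLNM1716] §3 Lemmas 3.1–3.3, §4 Lemma 4.2; [GreenbergVatsal2000] §2 pp. 17–21; [Agboola2007] §3 Prop. 3.2, §4, §6 Prop. 6.10–6.12;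
[Rubin1999] §3 Lemma 3.6 (ii), Cor. 3.17.
-/

noncomputable section

open scoped Classical
-- the summit namespace `Summit.BirchSwinnertonDyer.BirchSwinnertonDyer` repeats the problem name by design (D-0017)
set_option linter.dupNamespace false
set_option autoImplicit false

open NumberField IsDedekindDomain Field WeierstrassCurve
open Literature.NumberTheory.EllipticCurves Literature.NumberTheory.EllipticCurves.GreenbergSelmer
open Literature.NumberTheory.EllipticCurves.GreenbergVatsal2000 Literature.NumberTheory.EllipticCurves.KellerYin2024
open Literature.NumberTheory.EllipticCurves.Agboola2007
open Literature.NumberTheory.EllipticCurves.IwasawaDual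
open Literature.NumberTheory.EllipticCurves.ResKernel
open Literature.NumberTheory.GaloisRepresentations
open Summit.BirchSwinnertonDyer.BirchSwinnertonDyer.Theorems.PrintCf2.RestrictedSelmerPair

namespace Summit.BirchSwinnertonDyer.BirchSwinnertonDyer.Theorems.PrintCf2.UnrInvariants

/-! ## §3. Road α frames -/

section Frame

open Summit.BirchSwinnertonDyer.BirchSwinnertonDyer.Theorems.PrintCf2.AdditiveAtSeven
open Summit.BirchSwinnertonDyer.BirchSwinnertonDyer.Theorems.PrintCf2.CMPrimes

variable {K : Type} [Field K] [NumberField K]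

/-- **`W*^{I_v̄}` IS FINITE on every frame** (member `C • W = cm7^{(d)}`, `K` imaginary quadratic with `2 = v v̄`, `π² = π − 2`, `r² = r − 2`,
pinning clause at `v` for `W* = E[𝔮_r^∞]`): by the `v ↔ v̄` swap of the pinning clause (`CMPrimes.endEigenPrimaryTorsion_two_pinningClause_swap`)
some element of `I_v̄` moves a point of `W*`; since `W*` is COCYCLIC (`CMPrimes.eq_of_le_of_infinite`: an infinite subgroup is everything) the
`I_v̄`-fixed subgroup, being proper, is finite — `W*` is of kernel-of-reduction type at `v̄`. [cite: Rubin1999, §3 Lemma 3.6 (ii), Cor. 3.17]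
[cite: GreenbergLNM1716, §2 p. 70] -/
theorem finite_fixedPoints_inertia_vbar_of_frame {d : ℤ} (hd0 : d ≠ 0) (W : WeierstrassCurve ℚ) [W.IsElliptic]
    (C : VariableChange ℚ) (hC : C • W = cm7.quadraticTwist (d : ℚ)) (hK : IsImaginaryQuadratic K)
    {v vbar : HeightOneSpectrum (𝓞 K)} (hv : ((2 : ℕ) : 𝓞 K) ∈ v.asIdeal) (hvbar : ((2 : ℕ) : 𝓞 K) ∈ vbar.asIdeal) (hne : vbar ≠ v)
    (π : (W.baseChange K).endRing) (hrel : (π : AddMonoid.End (W.baseChange K).geomPoints) * π = π - 2)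
    {r : ℤ_[2]} (hr : r * r = r - 2)
    (hpin : ∀ τ ∈ inertia v, ∀ x : ↥((W.baseChange K).endEigenPrimaryTorsion 2 π r), τ • x = x ∨ τ • x = -x) :
    Finite (FixedPoints.addSubgroup (inertia vbar) ↥((W.baseChange K).endEigenPrimaryTorsion 2 π r)) := by
  haveI : Fact (Nat.Prime 2) := ⟨Nat.prime_two⟩
  have hj : W.j = -3375 := j_eq_of_smul_eq_cm7Twist hd0 W C hC
  obtain ⟨θ, hθ⟩ := exists_sq_eq_neg_seven_of_cmEndo_mem_endRing W K hj π hrel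
  obtain ⟨-, hnot⟩ := endEigenPrimaryTorsion_two_pinningClause_swap W K hj hK hθ π hrel hr hv hvbar hne hpin
  set Cr := (W.baseChange K).endEigenPrimaryTorsion 2 π r with hCr
  by_contra hinf
  let F : AddSubgroup ((W.baseChange K).geomPrimaryTorsion 2) := (FixedPoints.addSubgroup (inertia vbar) ↥Cr).map Cr.subtype
  have hFle : F ≤ Cr := by
    rintro _ ⟨x, -, rfl⟩
    exact x.2
  have hFinf : ¬ Finite ↥F := by
    intro hF
    exact hinf (Finite.of_equiv _ (AddSubgroup.equivMapOfInjective _ Cr.subtype Subtype.val_injective).toEquiv.symm)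
  have hFeq := CMPrimes.eq_of_le_of_infinite W K hj hθ π hrel hr hFle hFinf
  refine hnot fun τ hτ x ↦ Or.inl ?_
  have hx : (x : (W.baseChange K).geomPrimaryTorsion 2) ∈ F := by
    rw [hFeq]
    exact x.2
  obtain ⟨y, hy, hyx⟩ := hx
  have hyx' : y = x := Subtype.ext hyx
  rw [← hyx']
  exact hy ⟨τ, hτ⟩

/-- **(unr-INV) ON THE FRAMES, from the finiteness of `𝔖_{v̄}(K, W*)`.** Member `C • W = cm7^{(d)}` (`d ≠ 0` squarefree), `K` imaginary quadratic,
`2 = v v̄`, `π² = π − 2`, `r² = r − 2`, pinning clause at `v` for `W*`, THE line `κ'` unramified outside `v̄` with topological generator `γ'`: if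
Agboola's restricted Selmer group `𝔖_{v̄}(K, W*)` at level `K` is finite then **the `Γ`-invariants of the UNRAMIFIED line group
`S_{W*}(K*_∞) = H¹_{𝓕_nr}(K*_∞, W*)` are FINITE**. Ingredients: `𝔖_{v̄}(K*_∞, W*)^Γ` finite (-w5 `finite_endInvariants_of_frame_of_finite_restrictedSelmerBase`),
«unramified = locally trivial at `w ∤ 2` over the line» (-w6 g4 `LineLocallyTrivial.awayKer_eq_unramifiedKer_of_frame`), `K` totally complex, the
local finiteness §1 at `v̄` fed by `finite_fixedPoints_inertia_vbar_of_frame`, and the global lemma §2.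
[cite: GreenbergLNM1716, §3–§4] [cite: Agboola2007, §3 Prop. 3.2, §4] [cite: GreenbergVatsal2000, §2 pp. 17–21] -/
theorem finite_endInvariants_conjUnr_of_frame_of_finite_restrictedSelmerBase {d : ℤ} (hd0 : d ≠ 0) (hsq : Squarefree d)
    (W : WeierstrassCurve ℚ) [W.IsElliptic] (C : VariableChange ℚ) (hC : C • W = cm7.quadraticTwist (d : ℚ))
    (hK : IsImaginaryQuadratic K) {v vbar : HeightOneSpectrum (𝓞 K)} (hv : ((2 : ℕ) : 𝓞 K) ∈ v.asIdeal)
    (hvbar : ((2 : ℕ) : 𝓞 K) ∈ vbar.asIdeal) (hne : vbar ≠ v) (π : (W.baseChange K).endRing)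
    (hrel : (π : AddMonoid.End (W.baseChange K).geomPoints) * π = π - 2) {r : ℤ_[2]} (hr : r * r = r - 2)
    (hpin : ∀ τ ∈ inertia v, ∀ x : ↥((W.baseChange K).endEigenPrimaryTorsion 2 π r), τ • x = x ∨ τ • x = -x)
    (κ' : ZpExtension K 2) (hκ' : κ'.IsUnramifiedOutside vbar) {γ' : absoluteGaloisGroup K} (hγ' : κ'.IsTopGenerator γ')
    (hB : Finite (restrictedSelmerBase ↥((W.baseChange K).endEigenPrimaryTorsion 2 π r) 2 vbar)) :
    Finite (endInvariants (conjUnr κ' ↥((W.baseChange K).endEigenPrimaryTorsion 2 π r) vbar ∅ γ' - 1)) := by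
  haveI : Fact (Nat.Prime 2) := ⟨Nat.prime_two⟩
  haveI : (W.baseChange K).IsElliptic := by rw [baseChange]; infer_instance
  have hcont := continuous_smul_endEigenPrimaryTorsion (W.baseChange K) 2 π r
  have hstab := isOpen_stabilizer_endEigenPrimaryTorsion (W.baseChange K) 2 π r
  have hprim := exists_pow_smul_endEigenPrimaryTorsion_eq_zero (W.baseChange K) 2 π r
  have htors : ∀ n : ℕ, Finite (AddSubgroup.torsionBy ↥((W.baseChange K).endEigenPrimaryTorsion 2 π r) (2 ^ n : ℕ)) := by
    intro n
    haveI := (W.baseChange K).finite_torsionBy_geomPrimaryTorsion 2 n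
    refine Finite.of_injective (fun b : AddSubgroup.torsionBy ↥((W.baseChange K).endEigenPrimaryTorsion 2 π r) (2 ^ n : ℕ) ↦
      (⟨((b : ↥((W.baseChange K).endEigenPrimaryTorsion 2 π r)) : (W.baseChange K).geomPrimaryTorsion 2), ?_⟩ :
        AddSubgroup.torsionBy ((W.baseChange K).geomPrimaryTorsion 2) (2 ^ n : ℕ))) ?_
    · have hb := b.2
      rw [AddSubgroup.torsionBy.nsmul_iff] at hb ⊢
      have h := congrArg (fun z : ↥((W.baseChange K).endEigenPrimaryTorsion 2 π r) ↦ (z : (W.baseChange K).geomPrimaryTorsion 2)) hb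
      simpa only [AddSubmonoidClass.coe_nsmul, ZeroMemClass.coe_zero] using h
    · intro a b hab
      apply Subtype.ext
      apply Subtype.ext
      exact congrArg (fun z : AddSubgroup.torsionBy ((W.baseChange K).geomPrimaryTorsion 2) (2 ^ n : ℕ) ↦
        (z : (W.baseChange K).geomPrimaryTorsion 2)) hab
  haveI := finite_fixedPoints_inertia_vbar_of_frame hd0 W C hC hK hv hvbar hne π hrel hr hpin
  have hloc := finite_subgroupResKer_kerSubgroup_inf_inertia κ' ↥((W.baseChange K).endEigenPrimaryTorsion 2 π r) vbar
    hcont hstab hprim htors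
  have hS := finite_endInvariants_of_frame_of_finite_restrictedSelmerBase hd0 hsq W C hC hK hv hvbar hne π hrel hr κ' hκ' hγ' hB
  exact finite_endInvariants_conjUnr_of_local κ' ↥((W.baseChange K).endEigenPrimaryTorsion 2 π r) vbar hγ' hvbar hcont hprim
    (fun w ↦ (IsImaginaryQuadratic.isTotallyComplex hK).isComplex w)
    (fun w hw ↦ LineLocallyTrivial.awayKer_eq_unramifiedKer_of_frame W hK hv hvbar hne π r κ' hκ' hw) hloc hS

/-- **(unr-INV) ON THE v12 FRAME, NO DISPLAYED HYPOTHESIS.** For every member `C • W = cm7^{(d)}` (`d ≠ 0` squarefree, `d % 4 ≠ 1`, globally minimal,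
analytic rank one, `Finite W.sha`), `K` imaginary quadratic with `2 = v v̄`, `π² = π − 2`, `r² = r − 2` with the pinning clause at `v`, THE line `κ'`
unramified outside `v̄` with generator `γ'`, and the `ℚ`-generator datum `(P, c₀, ℓ)` — the binders of S3d `stub_strictDefectAtVbar_two` VERBATIM —
**`H¹_{𝓕_nr}(K*_∞, W*)^Γ` is finite** (the previous theorem with `𝔖_{v̄}(K, W*)` finite by (FIN) = `RelaxationLift.finite_restrictedSelmerBase_of_frame`,
p688193). [cite: Agboola2007, §6 Prop. 6.10–6.12] [cite: GreenbergLNM1716, §3–§4] [cite: GreenbergVatsal2000, §2 pp. 17–21] -/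
theorem finite_endInvariants_conjUnr_of_frame :
    ∀ (d : ℤ), d ≠ 0 → Squarefree d → d % 4 ≠ 1 →
      ∀ (W : WeierstrassCurve ℚ) [W.IsElliptic] [W.IsGloballyMinimal] (C : VariableChange ℚ),
        C • W = cm7.quadraticTwist (d : ℚ) → W.analyticRank = 1 → Finite W.sha →
      ∀ (K : Type) [Field K] [NumberField K], IsImaginaryQuadratic K →
      ∀ (v vbar : HeightOneSpectrum (𝓞 K)),
        ((2 : ℕ) : 𝓞 K) ∈ v.asIdeal → ((2 : ℕ) : 𝓞 K) ∈ vbar.asIdeal → vbar ≠ v →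
      ∀ (π : (W.baseChange K).endRing), (π : AddMonoid.End (W.baseChange K).geomPoints) * π = π - 2 →
      ∀ (r : ℤ_[2]), r * r = r - 2 →
        (∀ τ ∈ GreenbergSelmer.inertia v, ∀ x : ↥((W.baseChange K).endEigenPrimaryTorsion 2 π r), τ • x = x ∨ τ • x = -x) →
      ∀ (κ' : ZpExtension K 2), κ'.IsUnramifiedOutside vbar → ∀ (γ' : absoluteGaloisGroup K), κ'.IsTopGenerator γ' →
      ∀ (P : W.toAffine.Point) (c₀ : ℕ) (ℓ : ℤ),
        ¬ IsOfFinAddOrder P →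
        (∀ R : W.toAffine.Point, ∃ (k : ℤ) (T : W.toAffine.Point), IsOfFinAddOrder T ∧ R = k • P + T) →
        c₀ ≠ 0 → (W.baseChange ℚ_[2]).IsInReductionKernel (c₀ • W.toPadicPoint 2 P) →
        ‖(W.baseChange ℚ_[2]).padicLogPoint (c₀ • W.toPadicPoint 2 P) / (c₀ : ℚ_[2])‖ = (2 : ℝ) ^ (-ℓ) →
      Finite (endInvariants (conjUnr κ' ↥((W.baseChange K).endEigenPrimaryTorsion 2 π r) vbar ∅ γ' - 1)) := by
  intro d hd0 hsq hd4 W _ _ C hC hrank hsha K _ _ hK v vbar hv hvbar hne π hrel r hr hpin κ' hκ' γ' hγ' P c₀ ℓ hP hgen hc₀ hker hlog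
  exact finite_endInvariants_conjUnr_of_frame_of_finite_restrictedSelmerBase hd0 hsq W C hC hK hv hvbar hne π hrel hr hpin κ' hκ' hγ'
    (RelaxationLift.finite_restrictedSelmerBase_of_frame d hd0 hsq hd4 W C hC hrank hsha K hK v vbar hv hvbar hne π hrel r hr hpin
      P c₀ ℓ hP hgen hc₀ hker hlog)

/-- **THE GREENBERG–VATSAL DATUM OF S3b′-v12 IS FINITELY GENERATED, TORSION, WITH `H(0) ≠ 0` — on every v12 frame, for EVERY dual datum of the
unramified line group, hypothesis-free.** Same binders as `finite_endInvariants_conjUnr_of_frame`, then for every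
`D : DatumDualData κ' γ' W* (bdpData W* 2 v̄) ∅`: `Module.Finite Λ D.X ∧ IsTorsion Λ D.X ∧ ∃ H, ch_Λ(D.X) = (H) ∧ H(0) ≠ 0` (cf2c-w8 g2's read-out
`LinePush.finite_isTorsion_exists_charIdeal_of_finite_endInvariants_unr` fed with `finite_endInvariants_conjUnr_of_frame`). These are the conjuncts
`Module.Finite`, `IsTorsion`, `charIdeal = span {H}`, `constantCoeff H ≠ 0` of the LEAD's `stub_restrictedMainConj_two_v12` for the unramified datum, which
(TW)+(RES)+(SP)+(VAL) do not produce; the remaining conjuncts (valuation `n`, value law) are the push proper. [cite: GreenbergLNM1716, §4 Lemma 4.2 and Remark]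
[cite: Agboola2007, §4, §6] [cite: GreenbergVatsal2000, §2 pp. 17–21] -/
theorem datumDualData_unr_of_frame :
    ∀ (d : ℤ), d ≠ 0 → Squarefree d → d % 4 ≠ 1 →
      ∀ (W : WeierstrassCurve ℚ) [W.IsElliptic] [W.IsGloballyMinimal] (C : VariableChange ℚ),
        C • W = cm7.quadraticTwist (d : ℚ) → W.analyticRank = 1 → Finite W.sha →
      ∀ (K : Type) [Field K] [NumberField K], IsImaginaryQuadratic K →
      ∀ (v vbar : HeightOneSpectrum (𝓞 K)),
        ((2 : ℕ) : 𝓞 K) ∈ v.asIdeal → ((2 : ℕ) : 𝓞 K) ∈ vbar.asIdeal → vbar ≠ v →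
      ∀ (π : (W.baseChange K).endRing), (π : AddMonoid.End (W.baseChange K).geomPoints) * π = π - 2 →
      ∀ (r : ℤ_[2]), r * r = r - 2 →
        (∀ τ ∈ GreenbergSelmer.inertia v, ∀ x : ↥((W.baseChange K).endEigenPrimaryTorsion 2 π r), τ • x = x ∨ τ • x = -x) →
      ∀ (κ' : ZpExtension K 2), κ'.IsUnramifiedOutside vbar → ∀ (γ' : absoluteGaloisGroup K), κ'.IsTopGenerator γ' →
      ∀ (P : W.toAffine.Point) (c₀ : ℕ) (ℓ : ℤ),
        ¬ IsOfFinAddOrder P →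
        (∀ R : W.toAffine.Point, ∃ (k : ℤ) (T : W.toAffine.Point), IsOfFinAddOrder T ∧ R = k • P + T) →
        c₀ ≠ 0 → (W.baseChange ℚ_[2]).IsInReductionKernel (c₀ • W.toPadicPoint 2 P) →
        ‖(W.baseChange ℚ_[2]).padicLogPoint (c₀ • W.toPadicPoint 2 P) / (c₀ : ℚ_[2])‖ = (2 : ℝ) ^ (-ℓ) →
      ∀ D : DatumDualData κ' γ' ↥((W.baseChange K).endEigenPrimaryTorsion 2 π r)
          (Castella2018.AcSelmer.bdpData ↥((W.baseChange K).endEigenPrimaryTorsion 2 π r) 2 vbar) ∅,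
        Module.Finite (IwasawaAlgebra 2) D.X ∧ Module.IsTorsion (IwasawaAlgebra 2) D.X ∧
          ∃ H : IwasawaAlgebra 2, Module.charIdeal (IwasawaAlgebra 2) D.X = Ideal.span {H} ∧ PowerSeries.constantCoeff H ≠ 0 := by
  intro d hd0 hsq hd4 W _ _ C hC hrank hsha K _ _ hK v vbar hv hvbar hne π hrel r hr hpin κ' hκ' γ' hγ' P c₀ ℓ hP hgen hc₀ hker hlog D
  haveI : Fact (Nat.Prime 2) := ⟨Nat.prime_two⟩
  exact LinePush.finite_isTorsion_exists_charIdeal_of_finite_endInvariants_unr D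
    (exists_pow_smul_endEigenPrimaryTorsion_eq_zero (W.baseChange K) 2 π r) (isOpen_stabilizer_endEigenPrimaryTorsion (W.baseChange K) 2 π r) hγ'
    (finite_endInvariants_conjUnr_of_frame d hd0 hsq hd4 W C hC hrank hsha K hK v vbar hv hvbar hne π hrel r hr hpin κ' hκ' γ' hγ'
      P c₀ ℓ hP hgen hc₀ hker hlog)

end Frame

end Summit.BirchSwinnertonDyer.BirchSwinnertonDyer.Theorems.PrintCf2.UnrInvariants
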